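import Literature.Analysis.Complex.ThricePuncturedSphereEnds
import Literature.Analysis.Complex.EntireInjectiveAffine
import HarnessLib

/-!
# Biholomorphic automorphisms of the thrice-punctured sphere, II: `Aut(ℂ ∖ {0,1})` is the anharmonic group

Classical: every biholomorphic self-map of `ℂ ∖ {0, 1}` is (the restriction of) one of the six Möbius
transformations permuting `{0, 1, ∞}`,
`z,  1 - z,  1/z,  1/(1 - z),  1 - 1/z = (z-1)/z,  1 - 1/(1-z) = z/(z-1)`
(J. B. Conway, *Functions of One Complex Variable I* (1978): isolated singularities Ch. V Def. 1.3 /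
Thm. 1.21, Möbius transformations Ch. III §3; the affine conclusion through the tree's
`EntireInjectiveAffine` = Conway Ch. V exercises).  Typed over abc-iut-L4's `holAut`
([AbsTopIII] Def. 2.1 (i): the group `Aut^hol(U)` of biholomorphic self-homeomorphisms of an open `U`
of a Riemann surface), for any `U : Opens ℂ` with `(U : Set ℂ) = {z | z ≠ 0 ∧ z ≠ 1}`:

* `ThricePunctured.exists_oneSub_mem_holAut` / `exists_inv_mem_holAut` — `z ↦ 1 - z` and `z ↦ z⁻¹`
  are elements of `Aut^hol(ℂ ∖ {0,1})` (they generate the anharmonic group `S₃`);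
* `ThricePunctured.eq_id_of_fix_ends` — an automorphism fixing the three punctures `0, 1, ∞` is the
  identity (it extends to an injective proper entire function, hence is affine, fixing `0` and `1`);
* `ThricePunctured.eq_one_of_six` — **the classification**: every `φ ∈ holAut U` is one of the six maps.

Consequence used by the abc-iut cell: `Aut^hol` of the hyperbolic curve `P¹ ∖ {0,1,∞}` is FINITE (order
`6`), so a homeomorphism normalising it need not respect any finer structure.  No definitions.
[cite: Conway1978, Ch. V Thm. 1.21 and Def. 1.3]
-/

noncomputable section

namespace Literature.Analysis.Complex

namespace ThricePunctured

open Filter Topology Metric Bornology Set Function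
open scoped Manifold ContDiff
open _root_.TopologicalSpace (Opens)
open Literature.AnabelianGeometry.AbsoluteAnabelian

variable {U : Opens ℂ} (hU : (U : Set ℂ) = {z | z ≠ 0 ∧ z ≠ 1})

/-! ### Holomorphy of self-maps of an open subset of `ℂ` given by an ambient formula -/

/-- A self-map `ψ` of an open `U ⊆ ℂ` that is the restriction of an ambient `Φ : ℂ → ℂ` is holomorphic
(`MDifferentiable` for `𝓘(ℂ, ℂ)`) as soon as `Φ` is complex differentiable at the points of `U`.
[cite: Conway1978, Ch. V Def. 1.3] -/
theorem mdifferentiable_of_differentiableAt {V : Opens ℂ} {Φ : ℂ → ℂ} {ψ : V → V}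
    (hψ : ∀ x, (ψ x : ℂ) = Φ x) (hΦ : ∀ z ∈ V, DifferentiableAt ℂ Φ z) :
    MDifferentiable 𝓘(ℂ, ℂ) 𝓘(ℂ, ℂ) ψ := fun x => by
  rw [mdifferentiableAt_opens_iff hψ x]
  exact mdifferentiableAt_iff_differentiableAt.mpr (hΦ x x.2)

/-! ### The generators `z ↦ 1 - z` and `z ↦ z⁻¹` of the anharmonic group -/

include hU in
/-- `z ↦ 1 - z` is a biholomorphic automorphism of `ℂ ∖ {0,1}` (it swaps the punctures `0, 1` and fixes
`∞`). [cite: Conway1978, Ch. V Def. 1.3] -/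
theorem exists_oneSub_mem_holAut :
    ∃ σ : U ≃ₜ U, σ ∈ holAut U ∧ ∀ x : U, (σ x : ℂ) = 1 - x := by
  have hmem : ∀ z ∈ U, (1 : ℂ) - z ∈ U := fun z hz => by
    rw [mem_iff hU] at hz ⊢
    exact ⟨sub_ne_zero.mpr (Ne.symm hz.2), fun h => hz.1 (by linear_combination -h)⟩
  have hcont : Continuous fun x : U => (⟨1 - x, hmem x x.2⟩ : U) :=
    (continuous_const.sub continuous_subtype_val).subtype_mk _
  let σ : U ≃ₜ U :=
    { toFun := fun x => ⟨1 - x, hmem x x.2⟩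
      invFun := fun x => ⟨1 - x, hmem x x.2⟩
      left_inv := fun x => Subtype.ext (by simp)
      right_inv := fun x => Subtype.ext (by simp)
      continuous_toFun := hcont
      continuous_invFun := hcont }
  have hσ : ∀ x : U, (σ x : ℂ) = 1 - x := fun _ => rfl
  have hd : MDifferentiable 𝓘(ℂ, ℂ) 𝓘(ℂ, ℂ) σ :=
    mdifferentiable_of_differentiableAt (Φ := fun z => 1 - z) hσ
      fun z _ => (differentiableAt_const _).sub differentiableAt_id
  exact ⟨σ, (mem_holAut_iff σ).mpr ⟨hd, hd⟩, hσ⟩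

include hU in
/-- `z ↦ z⁻¹` is a biholomorphic automorphism of `ℂ ∖ {0,1}` (it swaps the punctures `0, ∞` and fixes
`1`). [cite: Conway1978, Ch. V Def. 1.3] -/
theorem exists_inv_mem_holAut :
    ∃ τ : U ≃ₜ U, τ ∈ holAut U ∧ ∀ x : U, (τ x : ℂ) = (x : ℂ)⁻¹ := by
  have hmem : ∀ z ∈ U, (z : ℂ)⁻¹ ∈ U := fun z hz => by
    rw [mem_iff hU] at hz ⊢
    exact ⟨inv_ne_zero hz.1, fun h => hz.2 (inv_eq_one.mp h)⟩
  have hne : ∀ x : U, (x : ℂ) ≠ 0 := fun x => ((mem_iff hU).mp x.2).1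
  have hcont : Continuous fun x : U => (⟨(x : ℂ)⁻¹, hmem x x.2⟩ : U) :=
    (continuous_subtype_val.inv₀ hne).subtype_mk _
  let τ : U ≃ₜ U :=
    { toFun := fun x => ⟨(x : ℂ)⁻¹, hmem x x.2⟩
      invFun := fun x => ⟨(x : ℂ)⁻¹, hmem x x.2⟩
      left_inv := fun x => Subtype.ext (by simp)
      right_inv := fun x => Subtype.ext (by simp)
      continuous_toFun := hcont
      continuous_invFun := hcont }
  have hτ : ∀ x : U, (τ x : ℂ) = (x : ℂ)⁻¹ := fun _ => rfl
  have hd : MDifferentiable 𝓘(ℂ, ℂ) 𝓘(ℂ, ℂ) τ :=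
    mdifferentiable_of_differentiableAt (Φ := fun z => z⁻¹) hτ
      fun z hz => differentiableAt_inv (((mem_iff hU).mp hz).1)
  exact ⟨τ, (mem_holAut_iff τ).mpr ⟨hd, hd⟩, hτ⟩

/-! ### How the generators move the punctures (filter transport) -/

/-- `z ↦ 1 - z` maps the punctured neighbourhoods of `1` to those of `0`.
[cite: Conway1978, Ch. V Def. 1.3] -/
theorem tendsto_oneSub_nhdsNE_one : Tendsto (fun z : ℂ => 1 - z) (𝓝[≠] 1) (𝓝[≠] 0) := by
  refine tendsto_nhdsWithin_iff.mpr ⟨?_, ?_⟩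
  · have : Tendsto (fun z : ℂ => 1 - z) (𝓝 1) (𝓝 (1 - 1)) :=
      (tendsto_const_nhds.sub tendsto_id)
    rw [sub_self] at this
    exact this.mono_left nhdsWithin_le_nhds
  · exact eventually_mem_nhdsWithin.mono fun z (hz : z ≠ 1) h => hz (by
      have : (1 : ℂ) - z = 0 := h; linear_combination -this)

/-- `z ↦ 1 - z` fixes `∞`. [cite: Conway1978, Ch. V Def. 1.3] -/
theorem tendsto_oneSub_cocompact : Tendsto (fun z : ℂ => 1 - z) (cocompact ℂ) (cocompact ℂ) := by
  have h1 : Tendsto (fun z : ℂ => ‖z‖) (cocompact ℂ) atTop := tendsto_norm_cocompact_atTop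
  have h2 : Tendsto (fun z : ℂ => ‖z‖ + -1) (cocompact ℂ) atTop :=
    tendsto_atTop_add_const_right _ _ h1
  have h3 : Tendsto (fun z : ℂ => ‖1 - z‖) (cocompact ℂ) atTop :=
    tendsto_atTop_mono (fun z => by
      have := norm_sub_norm_le z (1 : ℂ)
      rw [norm_one, norm_sub_rev] at this
      linarith) h2
  rw [← cobounded_eq_cocompact] at h3 ⊢
  exact tendsto_norm_atTop_iff_cobounded.mp h3

/-- `z ↦ z⁻¹` maps the punctured neighbourhoods of `0` to `∞`. [cite: Conway1978, Ch. V Def. 1.3] -/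
theorem tendsto_inv_nhdsNE_zero : Tendsto (fun z : ℂ => z⁻¹) (𝓝[≠] 0) (cocompact ℂ) := by
  rw [← cobounded_eq_cocompact]; exact tendsto_inv₀_nhdsNE_zero

/-! ### The three puncture filters are pairwise distinct -/

/-- `𝓝[≠] 0 ≠ cocompact ℂ`. [cite: Conway1978, Ch. V Def. 1.3] -/
theorem nhdsNE_zero_ne_cocompact : 𝓝[≠] (0 : ℂ) ≠ cocompact ℂ := by
  intro h
  have hA : closedBall (0 : ℂ) 1 ∈ 𝓝[≠] (0 : ℂ) :=
    mem_nhdsWithin_of_mem_nhds (closedBall_mem_nhds _ one_pos)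
  have hB : (closedBall (0 : ℂ) 1)ᶜ ∈ 𝓝[≠] (0 : ℂ) := h ▸ (isCompact_closedBall _ _).compl_mem_cocompact
  have := inter_mem hA hB
  rw [inter_compl_self, empty_mem_iff_bot] at this
  exact (NormedField.nhdsNE_neBot (0 : ℂ)).ne this

/-- `𝓝[≠] 1 ≠ cocompact ℂ`. [cite: Conway1978, Ch. V Def. 1.3] -/
theorem nhdsNE_one_ne_cocompact : 𝓝[≠] (1 : ℂ) ≠ cocompact ℂ := by
  intro h
  have hA : closedBall (1 : ℂ) 1 ∈ 𝓝[≠] (1 : ℂ) :=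
    mem_nhdsWithin_of_mem_nhds (closedBall_mem_nhds _ one_pos)
  have hB : (closedBall (1 : ℂ) 1)ᶜ ∈ 𝓝[≠] (1 : ℂ) := h ▸ (isCompact_closedBall _ _).compl_mem_cocompact
  have := inter_mem hA hB
  rw [inter_compl_self, empty_mem_iff_bot] at this
  exact (NormedField.nhdsNE_neBot (1 : ℂ)).ne this

/-- `𝓝[≠] 0 ≠ 𝓝[≠] 1`. [cite: Conway1978, Ch. V Def. 1.3] -/
theorem nhdsNE_zero_ne_nhdsNE_one : 𝓝[≠] (0 : ℂ) ≠ 𝓝[≠] 1 := by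
  intro h
  have hA : closedBall (0 : ℂ) (1/3) ∈ 𝓝[≠] (0 : ℂ) :=
    mem_nhdsWithin_of_mem_nhds (closedBall_mem_nhds _ (by norm_num))
  have h1 : (1 : ℂ) ∉ closedBall (0 : ℂ) (1/3) := by
    rw [mem_closedBall, dist_zero_right, norm_one]; norm_num
  have hB : (closedBall (0 : ℂ) (1/3))ᶜ ∈ 𝓝[≠] (0 : ℂ) :=
    h ▸ mem_nhdsWithin_of_mem_nhds (isClosed_closedBall.isOpen_compl.mem_nhds h1)
  have := inter_mem hA hB
  rw [inter_compl_self, empty_mem_iff_bot] at this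
  exact (NormedField.nhdsNE_neBot (0 : ℂ)).ne this

/-! ### An automorphism fixing the three punctures is the identity -/

section Aut

variable {φ : U ≃ₜ U} {F : ℂ → ℂ}

include hU in
/-- **An automorphism of `ℂ ∖ {0,1}` fixing the punctures `0`, `1`, `∞` is the identity**: extended by
`0 ↦ 0`, `1 ↦ 1` it is an injective proper entire function (Riemann's removable singularity theorem at
`0` and `1`), hence affine (tree: `exists_eq_mul_add_of_differentiable_injective`, Conway Ch. V), hence
the identity. [cite: Conway1978, Ch. V Thm. 1.21 and Def. 1.3] -/
theorem eq_id_of_fix_ends (hφ : φ ∈ holAut U) (hF : ∀ x : U, (φ x : ℂ) = F x)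
    (h0 : Tendsto F (𝓝[≠] 0) (𝓝 0)) (h1 : Tendsto F (𝓝[≠] 1) (𝓝 1))
    (hinf : Tendsto F (cocompact ℂ) (cocompact ℂ)) : ∀ x : U, φ x = x := by
  classical
  -- the extension over the punctures
  let G : ℂ → ℂ := fun z => if z = 0 then 0 else if z = 1 then 1 else F z
  have hGU : ∀ z ∈ U, G z = F z := fun z hz => by
    have h := (mem_iff hU).mp hz
    simp only [G, if_neg h.1, if_neg h.2]
  have hG0 : G 0 = 0 := by simp [G]
  have hG1 : G 1 = 1 := by simp [G]
  have hUo : IsOpen (U : Set ℂ) := U.2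
  -- `G` agrees with `F` near every point of `U`, near the punctures (punctured) and near `∞`
  have hGF : ∀ z ∈ U, G =ᶠ[𝓝 z] F := fun z hz =>
    Filter.eventually_of_mem (hUo.mem_nhds hz) fun y hy => hGU y hy
  have hGF0 : G =ᶠ[𝓝[≠] (0 : ℂ)] F := (eventually_mem_nhdsNE_zero hU).mono fun y hy => hGU y hy
  have hGF1 : G =ᶠ[𝓝[≠] (1 : ℂ)] F := (eventually_mem_nhdsNE_one hU).mono fun y hy => hGU y hy
  have hGFi : G =ᶠ[cocompact ℂ] F := (eventually_mem_cocompact hU).mono fun y hy => hGU y hy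
  -- differentiability on `U`
  have hdU : ∀ z ∈ U, DifferentiableAt ℂ G z := fun z hz =>
    (differentiableAt hφ hF hz).congr_of_eventuallyEq (hGF z hz)
  -- continuity at the punctures
  have hc0 : ContinuousAt G 0 := by
    rw [← continuousWithinAt_compl_self, ContinuousWithinAt, hG0]
    exact h0.congr' hGF0.symm
  have hc1 : ContinuousAt G 1 := by
    rw [← continuousWithinAt_compl_self, ContinuousWithinAt, hG1]
    exact h1.congr' hGF1.symm
  -- differentiability at the punctures (removable singularities)
  have hball0 : ∀ z ∈ ball (0 : ℂ) 1 \ {0}, z ∈ U := by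
    rintro z ⟨hz, hz0⟩
    rw [mem_iff hU]
    refine ⟨hz0, fun h => ?_⟩
    rw [h, mem_ball, dist_zero_right, norm_one] at hz
    exact lt_irrefl _ hz
  have hball1 : ∀ z ∈ ball (1 : ℂ) 1 \ {1}, z ∈ U := by
    rintro z ⟨hz, hz1⟩
    rw [mem_iff hU]
    refine ⟨fun h => ?_, hz1⟩
    rw [h, mem_ball, dist_comm, dist_zero_right, norm_one] at hz
    exact lt_irrefl _ hz
  have hd0 : DifferentiableAt ℂ G 0 := by
    have h := (Complex.differentiableOn_compl_singleton_and_continuousAt_iff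
      (ball_mem_nhds (0 : ℂ) one_pos)).mp
      ⟨fun z hz => (hdU z (hball0 z hz)).differentiableWithinAt, hc0⟩
    exact h.differentiableAt (ball_mem_nhds _ one_pos)
  have hd1 : DifferentiableAt ℂ G 1 := by
    have h := (Complex.differentiableOn_compl_singleton_and_continuousAt_iff
      (ball_mem_nhds (1 : ℂ) one_pos)).mp
      ⟨fun z hz => (hdU z (hball1 z hz)).differentiableWithinAt, hc1⟩
    exact h.differentiableAt (ball_mem_nhds _ one_pos)
  have hdiff : Differentiable ℂ G := fun z => by
    by_cases hz0 : z = 0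
    · subst hz0; exact hd0
    by_cases hz1 : z = 1
    · subst hz1; exact hd1
    exact hdU z ((mem_iff hU).mpr ⟨hz0, hz1⟩)
  -- injectivity
  have hFU : ∀ z ∈ U, F z ∈ U := fun z hz => apply_mem hF hz
  have hinj : Injective G := by
    intro z z' h
    by_cases hz0 : z = 0
    · subst hz0
      by_cases hz0' : z' = 0
      · exact hz0'.symm
      by_cases hz1' : z' = 1
      · subst hz1'; rw [hG0, hG1] at h; exact absurd h zero_ne_one
      · have hz' : z' ∈ U := (mem_iff hU).mpr ⟨hz0', hz1'⟩
        rw [hG0, hGU z' hz'] at h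
        exact absurd h.symm ((mem_iff hU).mp (hFU z' hz')).1
    by_cases hz1 : z = 1
    · subst hz1
      by_cases hz0' : z' = 0
      · subst hz0'; rw [hG0, hG1] at h; exact absurd h.symm zero_ne_one
      by_cases hz1' : z' = 1
      · exact hz1'.symm
      · have hz' : z' ∈ U := (mem_iff hU).mpr ⟨hz0', hz1'⟩
        rw [hG1, hGU z' hz'] at h
        exact absurd h.symm ((mem_iff hU).mp (hFU z' hz')).2
    have hz : z ∈ U := (mem_iff hU).mpr ⟨hz0, hz1⟩
    by_cases hz0' : z' = 0
    · subst hz0'; rw [hG0, hGU z hz] at h; exact absurd h ((mem_iff hU).mp (hFU z hz)).1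
    by_cases hz1' : z' = 1
    · subst hz1'; rw [hG1, hGU z hz] at h; exact absurd h ((mem_iff hU).mp (hFU z hz)).2
    have hz' : z' ∈ U := (mem_iff hU).mpr ⟨hz0', hz1'⟩
    rw [hGU z hz, hGU z' hz'] at h
    exact injOn hF hz hz' h
  -- properness
  have hprop : Tendsto G (cocompact ℂ) (cocompact ℂ) := hinf.congr' hGFi.symm
  -- affine, fixing `0` and `1`: the identity
  obtain ⟨a, b, -, hab⟩ := exists_eq_mul_add_of_differentiable_injective hdiff hinj hprop
  have hb : b = 0 := by have := hab 0; rw [hG0, mul_zero, zero_add] at this; exact this.symm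
  have ha : a = 1 := by have := hab 1; rw [hG1, mul_one, hb, add_zero] at this; exact this.symm
  intro x
  apply Subtype.ext
  have := hab x
  rw [ha, hb, one_mul, add_zero, hGU x x.2, ← hF x] at this
  exact this

include hU in
/-- The case `∞ ↦ ∞`: an automorphism of `ℂ ∖ {0,1}` fixing the puncture `∞` is `z ↦ z` or `z ↦ 1 - z`.
[cite: Conway1978, Ch. V Thm. 1.21 and Def. 1.3] -/
theorem eq_id_or_oneSub_of_fix_infty (hφ : φ ∈ holAut U) (hF : ∀ x : U, (φ x : ℂ) = F x)
    (hinf : Tendsto F (cocompact ℂ) (cocompact ℂ)) :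
    (∀ x : U, (φ x : ℂ) = x) ∨ (∀ x : U, (φ x : ℂ) = 1 - x) := by
  have S0 : 𝓝[≠] (0 : ℂ) ∈ ({𝓝[≠] (0 : ℂ), 𝓝[≠] (1 : ℂ), cocompact ℂ} : Set (Filter ℂ)) := by simp
  have S1 : 𝓝[≠] (1 : ℂ) ∈ ({𝓝[≠] (0 : ℂ), 𝓝[≠] (1 : ℂ), cocompact ℂ} : Set (Filter ℂ)) := by simp
  have Si : cocompact ℂ ∈ ({𝓝[≠] (0 : ℂ), 𝓝[≠] (1 : ℂ), cocompact ℂ} : Set (Filter ℂ)) := by simp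
  -- where does `0` go?
  obtain ⟨l0, hl0, h0⟩ := end_trichotomy hU hφ hF S0
  rcases mem_ends_iff.mp hl0 with rfl | rfl | rfl
  · -- `0 ↦ 0`: then `1 ↦ 1` and `φ = id`
    left
    obtain ⟨l1, hl1, h1⟩ := end_trichotomy hU hφ hF S1
    rcases mem_ends_iff.mp hl1 with rfl | rfl | rfl
    · exact absurd (end_injective hU hφ hF S1 S0 S0 h1 h0) nhdsNE_zero_ne_nhdsNE_one.symm
    · intro x
      exact congrArg Subtype.val (eq_id_of_fix_ends hU hφ hF (h0.mono_right nhdsWithin_le_nhds)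
        (h1.mono_right nhdsWithin_le_nhds) hinf x)
    · exact absurd (end_injective hU hφ hF S1 Si Si h1 hinf) nhdsNE_one_ne_cocompact
  · -- `0 ↦ 1`: compose with `z ↦ 1 - z`
    right
    obtain ⟨σ, hσ, hσx⟩ := exists_oneSub_mem_holAut hU
    have hψ : σ * φ ∈ holAut U := (holAut U).mul_mem hσ hφ
    have hG : ∀ x : U, ((σ * φ) x : ℂ) = (fun z => 1 - F z) x := fun x => by
      rw [Homeomorph.mul_apply, hσx, hF]
    have g0 : Tendsto (fun z => 1 - F z) (𝓝[≠] 0) (𝓝[≠] 0) := tendsto_oneSub_nhdsNE_one.comp h0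
    have gi : Tendsto (fun z => 1 - F z) (cocompact ℂ) (cocompact ℂ) := tendsto_oneSub_cocompact.comp hinf
    obtain ⟨l1, hl1, g1⟩ := end_trichotomy (F := fun z => 1 - F z) hU hψ hG S1
    rcases mem_ends_iff.mp hl1 with rfl | rfl | rfl
    · exact absurd (end_injective (F := fun z => 1 - F z) hU hψ hG S1 S0 S0 g1 g0)
        nhdsNE_zero_ne_nhdsNE_one.symm
    · intro x
      have hx := eq_id_of_fix_ends (F := fun z => 1 - F z) hU hψ hG (g0.mono_right nhdsWithin_le_nhds)
        (g1.mono_right nhdsWithin_le_nhds) gi x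
      -- `σ (φ x) = x` ⇒ `φ x = σ x`
      have : ((σ * φ) x : ℂ) = x := congrArg Subtype.val hx
      rw [Homeomorph.mul_apply, hσx] at this
      linear_combination -this
    · exact absurd (end_injective (F := fun z => 1 - F z) hU hψ hG S1 Si Si g1 gi)
        nhdsNE_one_ne_cocompact
  · -- `0 ↦ ∞` is impossible since `∞ ↦ ∞`
    exact absurd (end_injective hU hφ hF S0 Si Si h0 hinf) nhdsNE_zero_ne_cocompact

include hU in
/-- **`Aut(ℂ ∖ {0,1})` is the anharmonic group.**  Every biholomorphic self-homeomorphism `φ` of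
`U = ℂ ∖ {0,1}` (`φ ∈ holAut U`, [AbsTopIII] Def. 2.1 (i)) is one of the six Möbius transformations
permuting `0, 1, ∞`: `z`, `1 - z`, `1/z`, `1/(1 - z)`, `1 - 1/z` (`= (z-1)/z`), `1 - 1/(1 - z)`
(`= z/(z-1)`).  (Where `∞` goes decides which of `id`, `z ↦ 1/z`, `z ↦ 1/(1-z)` to post-compose with;
then `eq_id_or_oneSub_of_fix_infty`.) [cite: Conway1978, Ch. V Thm. 1.21 and Def. 1.3] -/
theorem eq_one_of_six (hφ : φ ∈ holAut U) :
    (∀ x : U, (φ x : ℂ) = x) ∨ (∀ x : U, (φ x : ℂ) = 1 - x) ∨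
    (∀ x : U, (φ x : ℂ) = (x : ℂ)⁻¹) ∨ (∀ x : U, (φ x : ℂ) = (1 - x : ℂ)⁻¹) ∨
    (∀ x : U, (φ x : ℂ) = 1 - (x : ℂ)⁻¹) ∨ (∀ x : U, (φ x : ℂ) = 1 - (1 - x : ℂ)⁻¹) := by
  classical
  -- an ambient representative
  let F : ℂ → ℂ := fun z => if h : z ∈ U then (φ ⟨z, h⟩ : ℂ) else 0
  have hF : ∀ x : U, (φ x : ℂ) = F x := fun x => by simp only [F, dif_pos x.2]
  have Si : cocompact ℂ ∈ ({𝓝[≠] (0 : ℂ), 𝓝[≠] (1 : ℂ), cocompact ℂ} : Set (Filter ℂ)) := by simp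
  obtain ⟨σ, hσ, hσx⟩ := exists_oneSub_mem_holAut hU
  obtain ⟨τ, hτ, hτx⟩ := exists_inv_mem_holAut hU
  have hne0 : ∀ x : U, (x : ℂ) ≠ 0 := fun x => ((mem_iff hU).mp x.2).1
  have hne1 : ∀ x : U, (1 : ℂ) - x ≠ 0 := fun x => sub_ne_zero.mpr (Ne.symm ((mem_iff hU).mp x.2).2)
  have hφne0 : ∀ x : U, (φ x : ℂ) ≠ 0 := fun x => ((mem_iff hU).mp (φ x).2).1
  have hφne1 : ∀ x : U, (1 : ℂ) - φ x ≠ 0 := fun x =>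
    sub_ne_zero.mpr (Ne.symm ((mem_iff hU).mp (φ x).2).2)
  -- where does `∞` go?
  obtain ⟨li, hli, hi⟩ := end_trichotomy hU hφ hF Si
  rcases mem_ends_iff.mp hli with rfl | rfl | rfl
  · -- `∞ ↦ 0`: `τ ∘ φ` fixes `∞`
    have hψ : τ * φ ∈ holAut U := (holAut U).mul_mem hτ hφ
    have hG : ∀ x : U, ((τ * φ) x : ℂ) = (fun z => (F z)⁻¹) x := fun x => by
      rw [Homeomorph.mul_apply, hτx, hF]
    have gi : Tendsto (fun z => (F z)⁻¹) (cocompact ℂ) (cocompact ℂ) := tendsto_inv_nhdsNE_zero.comp hi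
    rcases eq_id_or_oneSub_of_fix_infty (F := fun z => (F z)⁻¹) hU hψ hG gi with h | h
    · -- `(φ x)⁻¹ = x`
      right; right; left
      intro x
      have := h x
      rw [Homeomorph.mul_apply, hτx] at this
      rw [← this, inv_inv]
    · -- `(φ x)⁻¹ = 1 - x`
      right; right; right; left
      intro x
      have := h x
      rw [Homeomorph.mul_apply, hτx] at this
      rw [← this, inv_inv]
  · -- `∞ ↦ 1`: `τ ∘ σ ∘ φ` fixes `∞`
    have hψ : τ * (σ * φ) ∈ holAut U := (holAut U).mul_mem hτ ((holAut U).mul_mem hσ hφ)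
    have hG : ∀ x : U, ((τ * (σ * φ)) x : ℂ) = (fun z => (1 - F z)⁻¹) x := fun x => by
      rw [Homeomorph.mul_apply, Homeomorph.mul_apply, hτx, hσx, hF]
    have gi : Tendsto (fun z => (1 - F z)⁻¹) (cocompact ℂ) (cocompact ℂ) :=
      tendsto_inv_nhdsNE_zero.comp (tendsto_oneSub_nhdsNE_one.comp hi)
    rcases eq_id_or_oneSub_of_fix_infty (F := fun z => (1 - F z)⁻¹) hU hψ hG gi with h | h
    · -- `(1 - φ x)⁻¹ = x` ⇒ `φ x = 1 - x⁻¹`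
      right; right; right; right; left
      intro x
      have := h x
      rw [Homeomorph.mul_apply, Homeomorph.mul_apply, hτx, hσx] at this
      have h2 : (1 : ℂ) - φ x = (x : ℂ)⁻¹ := by rw [← this, inv_inv]
      linear_combination -h2
    · -- `(1 - φ x)⁻¹ = 1 - x` ⇒ `φ x = 1 - (1 - x)⁻¹`
      right; right; right; right; right
      intro x
      have := h x
      rw [Homeomorph.mul_apply, Homeomorph.mul_apply, hτx, hσx] at this
      have h2 : (1 : ℂ) - φ x = ((1 : ℂ) - x)⁻¹ := by rw [← this, inv_inv]
      linear_combination -h2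
  · -- `∞ ↦ ∞`
    rcases eq_id_or_oneSub_of_fix_infty hU hφ hF hi with h | h
    · exact Or.inl h
    · exact Or.inr (Or.inl h)

end Aut

end ThricePunctured

end Literature.Analysis.Complex

end
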